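import Summits.Ventures.LatticeQCDFlow.Scoring.UnitaryConjugationLemmas
import Mathlib.Analysis.Complex.Polynomial.Basic
import Literature.RepresentationTheory.CompactGroups.UnitaryGroupCharacters
import HarnessLib

/-!
# Schur's lemma for the conjugation action of `U(N)` on `M_N(ℂ)`: a linear map commuting with every `X ↦ uXu*` is `X ↦ a·X + b·tr(X)·1`

HONEST FRAMING: exact (Metropolis-corrected) sampling algorithms for lattice gauge theory;
figures of merit are autocorrelation/cost numbers at stated couplings and volumes; no
continuum-physics claim.

Venture `LatticeQCDFlow` (cell pub-lqcd), sub-topic `Scoring`; FANOUT row 5 (`s0-sun-a`), GEN-20.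
NEW WORK of the cell (placement rule).  First input of the exact second moment of two-dimensional Wilson loops
(`E|tr W_{R×T}|² = 1 + (N² − 1)·P_adj(β)^{RT}`, successor files): the commutant of the conjugation representation of
`U(N)` on `M_N(ℂ) ≅ ℂ^N ⊗ (ℂ^N)*` is two-dimensional, spanned by the identity and `X ↦ tr(X)·1` (equivalently:
`M_N(ℂ) = ℂ·1 ⊕ sl_N(ℂ)` with `sl_N` irreducible).  Elementary proof, no representation theory:

* §1 diagonal phases `diag(1,…,i,…,1) ∈ U(N)` force `T(E_{jk}) ∈ ℂ·E_{jk}` (`j ≠ k`) and `T(E_{jj})` diagonal;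
* §2 permutation matrices force the constants to depend only on the pattern (`c`, `α = T(E_{jj})_{jj}`, `β' = T(E_{jj})_{aa}`);
* §3 the unitary `(1 + i·P_τ)/√2` (`τ` a transposition) forces `c = α − β'`;
* §4 **`linearMap_eq_of_commute_unitary_conj`** — `T X = c·X + β'·tr(X)·1` for all `X` (`N ≥ 2`; Mathlib `Matrix.ext_linearMap`
  on the matrix units `Matrix.single`).

No `def`, nothing cited as a fact, 0 sorry.
-/

noncomputable section

open Matrix Complex

namespace Summit.Ventures.LatticeQCDFlow.Scoring

section Commutant

variable {N : ℕ} (T : Matrix (Fin N) (Fin N) ℂ →ₗ[ℂ] Matrix (Fin N) (Fin N) ℂ)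

/-! ### 1. Diagonal phases -/

/-- **The torus test.**  If `T` commutes with conjugation by the diagonal phase at `m` and the phase factors of the
matrix units `E_{jk}` and `E_{ab}` under that conjugation differ, then `T(E_{jk})_{ab} = 0`. -/
theorem apply_single_entry_eq_zero (hT : ∀ (u : Matrix.unitaryGroup (Fin N) ℂ) (X : Matrix (Fin N) (Fin N) ℂ),
      T ((u : Matrix (Fin N) (Fin N) ℂ) * X * star (u : Matrix (Fin N) (Fin N) ℂ))
        = (u : Matrix (Fin N) (Fin N) ℂ) * T X * star (u : Matrix (Fin N) (Fin N) ℂ))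
    (j k a b m : Fin N)
    (hne : (if j = m then I else 1) * (starRingEnd ℂ) (if k = m then I else 1)
      ≠ (if a = m then I else 1) * (starRingEnd ℂ) (if b = m then I else 1)) :
    T (Matrix.single j k 1) a b = 0 := by
  set d : Fin N → ℂ := fun x => if x = m then I else 1 with hd
  have h := hT ⟨Matrix.diagonal d, diagonal_phase_mem_unitaryGroup m⟩ (Matrix.single j k 1)
  change T (Matrix.diagonal d * Matrix.single j k 1 * star (Matrix.diagonal d))
    = Matrix.diagonal d * T (Matrix.single j k 1) * star (Matrix.diagonal d) at h
  have hdsd : Matrix.diagonal d * Matrix.single j k (1 : ℂ) * Matrix.diagonal (star d)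
      = Matrix.single j k (d j * 1 * (star d) k) := by
    ext x y
    simp only [Matrix.mul_diagonal, Matrix.diagonal_mul, Matrix.single_apply]
    split_ifs with hxy
    · obtain ⟨rfl, rfl⟩ := hxy; ring
    · ring
  rw [Matrix.star_eq_conjTranspose, Matrix.diagonal_conjTranspose, hdsd] at h
  have hs : Matrix.single j k (d j * 1 * (star d) k) = (d j * (starRingEnd ℂ) (d k)) • Matrix.single j k (1 : ℂ) := by
    rw [Matrix.smul_single, smul_eq_mul, mul_one, mul_one]
    rfl
  rw [hs, map_smul] at h
  have hab := congrFun (congrFun h a) b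
  simp only [Matrix.smul_apply, smul_eq_mul, Matrix.mul_diagonal, Matrix.diagonal_mul, Pi.star_apply] at hab
  have hab' : T (Matrix.single j k 1) a b * (d j * (starRingEnd ℂ) (d k) - d a * (starRingEnd ℂ) (d b)) = 0 := by
    have e : (star (d b) : ℂ) = (starRingEnd ℂ) (d b) := rfl
    rw [e] at hab
    linear_combination hab
  rcases mul_eq_zero.1 hab' with h0 | h0
  · exact h0
  · exact absurd (sub_eq_zero.1 h0) hne

/-- **Off-diagonal matrix units are eigenvectors**: `T(E_{jk}) = T(E_{jk})_{jk} · E_{jk}` for `j ≠ k`. -/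
theorem apply_single_of_ne (hT : ∀ (u : Matrix.unitaryGroup (Fin N) ℂ) (X : Matrix (Fin N) (Fin N) ℂ),
      T ((u : Matrix (Fin N) (Fin N) ℂ) * X * star (u : Matrix (Fin N) (Fin N) ℂ))
        = (u : Matrix (Fin N) (Fin N) ℂ) * T X * star (u : Matrix (Fin N) (Fin N) ℂ))
    {j k : Fin N} (hjk : j ≠ k) :
    T (Matrix.single j k 1) = T (Matrix.single j k 1) j k • Matrix.single j k 1 := by
  ext a b
  rw [Matrix.smul_apply, Matrix.single_apply, smul_eq_mul]
  split_ifs with h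
  · obtain ⟨rfl, rfl⟩ := h
    rw [mul_one]
  · rw [mul_zero]
    by_cases ha : j = a
    · subst ha
      have hb : ¬ k = b := fun hb => h ⟨rfl, hb⟩
      refine apply_single_entry_eq_zero T hT j k j b k ?_
      have h1 : ¬ j = k := hjk
      have h2 : ¬ b = k := fun e => hb e.symm
      simp only [h1, if_false, if_true, h2, map_one, mul_one, Complex.conj_I, one_mul]
      exact fun e => neg_I_ne_one' e
    · refine apply_single_entry_eq_zero T hT j k a b j ?_
      have h1 : ¬ k = j := fun e => hjk e.symm
      have h2 : ¬ a = j := fun e => ha e.symm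
      simp only [if_true, h1, if_false, map_one, mul_one, h2, one_mul]
      by_cases h3 : b = j
      · simp only [h3, if_true, Complex.conj_I]; exact I_ne_neg_I'
      · simp only [h3, if_false, map_one]; exact I_ne_one'

/-- **Diagonal matrix units go to diagonal matrices**: `T(E_{jj})_{ab} = 0` for `a ≠ b`. -/
theorem apply_single_same_entry_eq_zero (hT : ∀ (u : Matrix.unitaryGroup (Fin N) ℂ) (X : Matrix (Fin N) (Fin N) ℂ),
      T ((u : Matrix (Fin N) (Fin N) ℂ) * X * star (u : Matrix (Fin N) (Fin N) ℂ))
        = (u : Matrix (Fin N) (Fin N) ℂ) * T X * star (u : Matrix (Fin N) (Fin N) ℂ))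
    (j : Fin N) {a b : Fin N} (hab : a ≠ b) :
    T (Matrix.single j j 1) a b = 0 := by
  refine apply_single_entry_eq_zero T hT j j a b a ?_
  have h2 : ¬ b = a := fun e => hab e.symm
  by_cases h1 : j = a
  · simp only [h1, if_true, Complex.conj_I, h2, if_false, map_one, mul_one, mul_neg, Complex.I_mul_I, neg_neg]
    exact fun e => I_ne_one' e.symm
  · simp only [h1, if_false, map_one, mul_one, if_true, h2]
    exact fun e => I_ne_one' e.symm

/-! ### 2. Permutation covariance -/

/-- **Permutation covariance**: `T(E_{σ⁻¹j, σ⁻¹k}) = (T E_{jk}) ∘ (σ × σ)`. -/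
theorem apply_single_perm (hT : ∀ (u : Matrix.unitaryGroup (Fin N) ℂ) (X : Matrix (Fin N) (Fin N) ℂ),
      T ((u : Matrix (Fin N) (Fin N) ℂ) * X * star (u : Matrix (Fin N) (Fin N) ℂ))
        = (u : Matrix (Fin N) (Fin N) ℂ) * T X * star (u : Matrix (Fin N) (Fin N) ℂ))
    (σ : Equiv.Perm (Fin N)) (j k : Fin N) :
    T (Matrix.single (σ.symm j) (σ.symm k) 1) = (T (Matrix.single j k 1)).submatrix σ σ := by
  have h := hT ⟨σ.toPEquiv.toMatrix, perm_toMatrix_mem_unitaryGroup σ⟩ (Matrix.single j k 1)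
  change T (σ.toPEquiv.toMatrix * Matrix.single j k 1 * star σ.toPEquiv.toMatrix)
    = σ.toPEquiv.toMatrix * T (Matrix.single j k 1) * star σ.toPEquiv.toMatrix at h
  rw [perm_conj_eq_submatrix, perm_conj_eq_submatrix, Matrix.submatrix_single_equiv] at h
  exact h

/-- The off-diagonal eigenvalue is permutation invariant. -/
theorem coeff_perm (hT : ∀ (u : Matrix.unitaryGroup (Fin N) ℂ) (X : Matrix (Fin N) (Fin N) ℂ),
      T ((u : Matrix (Fin N) (Fin N) ℂ) * X * star (u : Matrix (Fin N) (Fin N) ℂ))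
        = (u : Matrix (Fin N) (Fin N) ℂ) * T X * star (u : Matrix (Fin N) (Fin N) ℂ))
    (σ : Equiv.Perm (Fin N)) (j k : Fin N) :
    T (Matrix.single (σ.symm j) (σ.symm k) 1) (σ.symm j) (σ.symm k) = T (Matrix.single j k 1) j k := by
  rw [apply_single_perm T hT σ j k, Matrix.submatrix_apply, Equiv.apply_symm_apply, Equiv.apply_symm_apply]

/-- The diagonal values are permutation invariant. -/
theorem diag_perm (hT : ∀ (u : Matrix.unitaryGroup (Fin N) ℂ) (X : Matrix (Fin N) (Fin N) ℂ),
      T ((u : Matrix (Fin N) (Fin N) ℂ) * X * star (u : Matrix (Fin N) (Fin N) ℂ))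
        = (u : Matrix (Fin N) (Fin N) ℂ) * T X * star (u : Matrix (Fin N) (Fin N) ℂ))
    (σ : Equiv.Perm (Fin N)) (j a : Fin N) :
    T (Matrix.single (σ.symm j) (σ.symm j) 1) (σ.symm a) (σ.symm a) = T (Matrix.single j j 1) a a := by
  rw [apply_single_perm T hT σ j j, Matrix.submatrix_apply, Equiv.apply_symm_apply]

/-- **All off-diagonal eigenvalues coincide**: `T(E_{j'k'})_{j'k'} = T(E_{jk})_{jk}` for `j ≠ k`, `j' ≠ k'`. -/
theorem coeff_eq_coeff (hT : ∀ (u : Matrix.unitaryGroup (Fin N) ℂ) (X : Matrix (Fin N) (Fin N) ℂ),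
      T ((u : Matrix (Fin N) (Fin N) ℂ) * X * star (u : Matrix (Fin N) (Fin N) ℂ))
        = (u : Matrix (Fin N) (Fin N) ℂ) * T X * star (u : Matrix (Fin N) (Fin N) ℂ))
    {j k j' k' : Fin N} (hjk : j ≠ k) (hjk' : j' ≠ k') :
    T (Matrix.single j' k' 1) j' k' = T (Matrix.single j k 1) j k := by
  obtain ⟨σ, hj, hk⟩ := exists_perm_pair hjk hjk'
  rw [← coeff_perm T hT σ j k, hj, hk]

/-- **All diagonal self-values coincide**: `T(E_{j'j'})_{j'j'} = T(E_{jj})_{jj}`. -/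
theorem diag_self_eq (hT : ∀ (u : Matrix.unitaryGroup (Fin N) ℂ) (X : Matrix (Fin N) (Fin N) ℂ),
      T ((u : Matrix (Fin N) (Fin N) ℂ) * X * star (u : Matrix (Fin N) (Fin N) ℂ))
        = (u : Matrix (Fin N) (Fin N) ℂ) * T X * star (u : Matrix (Fin N) (Fin N) ℂ)) (j j' : Fin N) :
    T (Matrix.single j' j' 1) j' j' = T (Matrix.single j j 1) j j := by
  have h := diag_perm T hT (Equiv.swap j' j) j j
  rw [Equiv.symm_swap, Equiv.swap_apply_right] at h
  exact h

/-- **All diagonal cross-values coincide**: `T(E_{j'j'})_{a'a'} = T(E_{jj})_{aa}` for `a ≠ j`, `a' ≠ j'`. -/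
theorem diag_cross_eq (hT : ∀ (u : Matrix.unitaryGroup (Fin N) ℂ) (X : Matrix (Fin N) (Fin N) ℂ),
      T ((u : Matrix (Fin N) (Fin N) ℂ) * X * star (u : Matrix (Fin N) (Fin N) ℂ))
        = (u : Matrix (Fin N) (Fin N) ℂ) * T X * star (u : Matrix (Fin N) (Fin N) ℂ))
    {j a j' a' : Fin N} (hja : j ≠ a) (hja' : j' ≠ a') :
    T (Matrix.single j' j' 1) a' a' = T (Matrix.single j j 1) a a := by
  obtain ⟨σ, hj, ha⟩ := exists_perm_pair hja hja'
  rw [← diag_perm T hT σ j a, hj, ha]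

/-! ### 3. The mixing relation -/

/-- **The mixing relation**: `c = α − β'` — the off-diagonal eigenvalue equals the difference of the two diagonal values
(`p ≠ q`). -/
theorem coeff_eq_diag_sub (hT : ∀ (u : Matrix.unitaryGroup (Fin N) ℂ) (X : Matrix (Fin N) (Fin N) ℂ),
      T ((u : Matrix (Fin N) (Fin N) ℂ) * X * star (u : Matrix (Fin N) (Fin N) ℂ))
        = (u : Matrix (Fin N) (Fin N) ℂ) * T X * star (u : Matrix (Fin N) (Fin N) ℂ))
    {p q : Fin N} (hpq : p ≠ q) :
    T (Matrix.single p q 1) p q = T (Matrix.single p p 1) p p - T (Matrix.single p p 1) q q := by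
  set P : Matrix (Fin N) (Fin N) ℂ := (Equiv.swap p q).toPEquiv.toMatrix with hP
  have h := hT ⟨_, mixing_mem_unitaryGroup p q⟩ (Matrix.single p p 1)
  change T ((((1 + I) / 2) • (1 : Matrix (Fin N) (Fin N) ℂ) + ((1 - I) / 2) • P) * Matrix.single p p 1 *
      star (((1 + I) / 2) • (1 : Matrix (Fin N) (Fin N) ℂ) + ((1 - I) / 2) • P))
    = (((1 + I) / 2) • (1 : Matrix (Fin N) (Fin N) ℂ) + ((1 - I) / 2) • P) * T (Matrix.single p p 1) *
      star (((1 + I) / 2) • (1 : Matrix (Fin N) (Fin N) ℂ) + ((1 - I) / 2) • P) at h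
  have e1 : (star ((1 + I) / 2) : ℂ) = (1 - I) / 2 := by
    rw [Complex.star_def, map_div₀, map_add, map_one, Complex.conj_I, map_ofNat]; ring
  have e2 : (star ((1 - I) / 2) : ℂ) = (1 + I) / 2 := by
    rw [Complex.star_def, map_div₀, map_sub, map_one, Complex.conj_I, map_ofNat]; ring
  rw [star_add, star_smul, star_smul, star_one, hP, star_swap_toMatrix, e1, e2, smul_one_add_smul_mul_mul,
    smul_one_add_smul_mul_mul, swap_mul_single_mul_swap, swap_mul_single, single_mul_swap,
    map_add, map_add, map_add, map_smul, map_smul, map_smul, map_smul,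
    apply_single_of_ne T hT hpq, apply_single_of_ne T hT (Ne.symm hpq)] at h
  -- take the `(p, q)` entry
  have hpq' := congrFun (congrFun h p) q
  simp only [Matrix.add_apply, Matrix.smul_apply, smul_eq_mul, Matrix.single_apply, if_true, and_self,
    if_false, hpq, Ne.symm hpq, mul_one, mul_zero, add_zero] at hpq'
  rw [apply_single_same_entry_eq_zero T hT p hpq, apply_single_same_entry_eq_zero T hT q hpq,
    mul_swap_toMatrix_apply, swap_toMatrix_mul_apply, mul_swap_toMatrix_apply, swap_toMatrix_mul_apply,
    Equiv.swap_apply_left, Equiv.swap_apply_right,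
    apply_single_same_entry_eq_zero T hT p (Ne.symm hpq)] at hpq'
  -- `hpq' : (I/2) c = (I/2) α − (I/2) β'`-shaped; cancel
  have c2 : (1 + I) / 2 * ((1 + I) / 2) = (I / 2 : ℂ) := by ring_nf; rw [Complex.I_sq]; ring
  have c3 : (1 - I) / 2 * ((1 - I) / 2) = (-(I / 2) : ℂ) := by ring_nf; rw [Complex.I_sq]; ring
  rw [c2, c3] at hpq'
  have hI : (I / 2 : ℂ) ≠ 0 := div_ne_zero Complex.I_ne_zero two_ne_zero
  have key : I / 2 * T (Matrix.single p q 1) p q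
      = I / 2 * (T (Matrix.single p p 1) p p - T (Matrix.single p p 1) q q) := by
    linear_combination hpq'
  exact mul_left_cancel₀ hI key

/-! ### 4. Conclusion -/

/-- **The values of `T` on the matrix units** (`N ≥ 2`, `p ≠ q` a reference pair): with `c = T(E_{pq})_{pq}` and
`β' = T(E_{pp})_{qq}`, `T(E_{jk}) = c·E_{jk} + β'·tr(E_{jk})·1` for all `j, k`. -/
theorem apply_single_eq (hT : ∀ (u : Matrix.unitaryGroup (Fin N) ℂ) (X : Matrix (Fin N) (Fin N) ℂ),
      T ((u : Matrix (Fin N) (Fin N) ℂ) * X * star (u : Matrix (Fin N) (Fin N) ℂ))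
        = (u : Matrix (Fin N) (Fin N) ℂ) * T X * star (u : Matrix (Fin N) (Fin N) ℂ))
    {p q : Fin N} (hpq : p ≠ q) (j k : Fin N) :
    T (Matrix.single j k 1) = T (Matrix.single p q 1) p q • Matrix.single j k 1
      + T (Matrix.single p p 1) q q • ((Matrix.single j k (1 : ℂ)).trace • (1 : Matrix (Fin N) (Fin N) ℂ)) := by
  by_cases hjk : j = k
  · subst hjk
    rw [Matrix.trace_single_eq_same, one_smul]
    ext a b
    rw [Matrix.add_apply, Matrix.smul_apply, Matrix.smul_apply, Matrix.single_apply, Matrix.one_apply, smul_eq_mul,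
      smul_eq_mul]
    by_cases hab : a = b
    · subst hab
      by_cases hja : j = a
      · subst hja
        simp only [and_self, if_true, mul_one]
        rw [diag_self_eq T hT p j, coeff_eq_diag_sub T hT hpq]
        ring
      · simp only [hja, if_false, and_self, if_true, mul_zero, zero_add, mul_one]
        exact diag_cross_eq T hT hpq hja
    · have h1 : ¬(j = a ∧ j = b) := fun h => hab (h.1.symm.trans h.2)
      simp only [h1, if_false, hab, mul_zero, add_zero]
      exact apply_single_same_entry_eq_zero T hT j hab
  · rw [Matrix.trace_single_eq_of_ne (h := hjk), zero_smul, smul_zero, add_zero, apply_single_of_ne T hT hjk,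
      coeff_eq_coeff T hT hpq hjk]

/-- **Schur's lemma for the conjugation action of `U(N)` on `M_N(ℂ)`** (`N ≥ 2`): a `ℂ`-linear map `T` on `N × N`
complex matrices with `T(uXu*) = u T(X) u*` for every unitary `u` is of the form `T(X) = a·X + b·tr(X)·1`. -/
theorem linearMap_eq_of_commute_unitary_conj (hN : 2 ≤ N) (hT : ∀ (u : Matrix.unitaryGroup (Fin N) ℂ) (X : Matrix (Fin N) (Fin N) ℂ),
      T ((u : Matrix (Fin N) (Fin N) ℂ) * X * star (u : Matrix (Fin N) (Fin N) ℂ))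
        = (u : Matrix (Fin N) (Fin N) ℂ) * T X * star (u : Matrix (Fin N) (Fin N) ℂ)) :
    ∃ a b : ℂ, ∀ X : Matrix (Fin N) (Fin N) ℂ, T X = a • X + b • (X.trace • (1 : Matrix (Fin N) (Fin N) ℂ)) := by
  set p : Fin N := ⟨0, by omega⟩
  set q : Fin N := ⟨1, by omega⟩
  have hpq : p ≠ q := by
    intro h
    have := congrArg Fin.val h
    simp [p, q] at this
  set a : ℂ := T (Matrix.single p q 1) p q with ha
  set b : ℂ := T (Matrix.single p p 1) q q with hb
  refine ⟨a, b, fun X => ?_⟩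
  -- compare `T` with the linear map `X ↦ a·X + b·tr(X)·1` on the matrix units
  set S : Matrix (Fin N) (Fin N) ℂ →ₗ[ℂ] Matrix (Fin N) (Fin N) ℂ :=
    a • LinearMap.id + b • ((LinearMap.toSpanSingleton ℂ (Matrix (Fin N) (Fin N) ℂ) 1).comp
      (Matrix.traceLinearMap (Fin N) ℂ ℂ)) with hS
  have hTS : T = S := by
    refine Matrix.ext_linearMap (R := ℂ) fun i j => ?_
    refine LinearMap.ext fun x => ?_
    rw [LinearMap.comp_apply, LinearMap.comp_apply, Matrix.singleLinearMap_apply]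
    have hx : Matrix.single i j x = x • Matrix.single i j (1 : ℂ) := by
      rw [Matrix.smul_single, smul_eq_mul, mul_one]
    have hij := apply_single_eq T hT hpq i j
    rw [← ha, ← hb] at hij
    rw [hx, map_smul, map_smul, hij]
    simp only [hS, LinearMap.add_apply, LinearMap.smul_apply, LinearMap.id_apply, LinearMap.comp_apply,
      Matrix.traceLinearMap_apply, LinearMap.toSpanSingleton_apply]
  rw [hTS]
  simp only [hS, LinearMap.add_apply, LinearMap.smul_apply, LinearMap.id_apply, LinearMap.comp_apply,
    Matrix.traceLinearMap_apply, LinearMap.toSpanSingleton_apply]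

/-! ### 5. From `SU(N)` to `U(N)` -/

/-- **Conjugation invariance under `SU(N)` implies conjugation invariance under `U(N)`**: every unitary is a unit-modulus
scalar times a special unitary, and scalars cancel in `uXu*`. -/
theorem commute_unitary_conj_of_specialUnitary [NeZero N]
    (hT : ∀ (v : Matrix.specialUnitaryGroup (Fin N) ℂ) (X : Matrix (Fin N) (Fin N) ℂ),
      T ((v : Matrix (Fin N) (Fin N) ℂ) * X * star (v : Matrix (Fin N) (Fin N) ℂ))
        = (v : Matrix (Fin N) (Fin N) ℂ) * T X * star (v : Matrix (Fin N) (Fin N) ℂ))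
    (u : Matrix.unitaryGroup (Fin N) ℂ) (X : Matrix (Fin N) (Fin N) ℂ) :
    T ((u : Matrix (Fin N) (Fin N) ℂ) * X * star (u : Matrix (Fin N) (Fin N) ℂ))
      = (u : Matrix (Fin N) (Fin N) ℂ) * T X * star (u : Matrix (Fin N) (Fin N) ℂ) := by
  have hN : 0 < N := Nat.pos_of_ne_zero (NeZero.ne N)
  -- an `N`-th root `c` of `det u`; `|c| = 1`
  obtain ⟨c, hc⟩ := IsAlgClosed.exists_pow_nat_eq ((u : Matrix (Fin N) (Fin N) ℂ).det) hN
  have hdet : ‖(u : Matrix (Fin N) (Fin N) ℂ).det‖ = 1 :=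
    Literature.RepresentationTheory.CompactGroups.UnitaryGroupChar.norm_det_eq_one u
  have hc1 : ‖c‖ = 1 := by
    have h : ‖c‖ ^ N = 1 := by rw [← norm_pow, hc, hdet]
    exact (pow_eq_one_iff_of_nonneg (norm_nonneg c) hN.ne').1 h
  have hc0 : c ≠ 0 := fun h => by rw [h, norm_zero] at hc1; exact zero_ne_one hc1
  have hcc : c * (starRingEnd ℂ) c = 1 := by
    rw [Complex.mul_conj, Complex.normSq_eq_norm_sq, hc1]; norm_num
  -- `c⁻¹ u ∈ SU(N)`
  have hcinv : c⁻¹ * (starRingEnd ℂ) c⁻¹ = 1 := by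
    rw [map_inv₀, ← mul_inv, hcc, inv_one]
  have hcinv' : (starRingEnd ℂ) c⁻¹ * c⁻¹ = 1 := by rw [mul_comm]; exact hcinv
  have hvu : c⁻¹ • (u : Matrix (Fin N) (Fin N) ℂ) ∈ Matrix.unitaryGroup (Fin N) ℂ := by
    rw [Matrix.mem_unitaryGroup_iff, star_smul, Matrix.smul_mul, Matrix.mul_smul, smul_smul,
      Matrix.mem_unitaryGroup_iff.mp u.2, Complex.star_def, hcinv, one_smul]
  have hvdet : (c⁻¹ • (u : Matrix (Fin N) (Fin N) ℂ)).det = 1 := by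
    rw [Matrix.det_smul, Fintype.card_fin, ← hc, inv_pow, inv_mul_cancel₀ (pow_ne_zero _ hc0)]
  have hvsu : c⁻¹ • (u : Matrix (Fin N) (Fin N) ℂ) ∈ Matrix.specialUnitaryGroup (Fin N) ℂ :=
    Matrix.mem_specialUnitaryGroup_iff.2 ⟨hvu, hvdet⟩
  -- the scalars cancel
  have h := hT ⟨c⁻¹ • (u : Matrix (Fin N) (Fin N) ℂ), hvsu⟩ X
  change T (c⁻¹ • (u : Matrix (Fin N) (Fin N) ℂ) * X * star (c⁻¹ • (u : Matrix (Fin N) (Fin N) ℂ)))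
    = c⁻¹ • (u : Matrix (Fin N) (Fin N) ℂ) * T X * star (c⁻¹ • (u : Matrix (Fin N) (Fin N) ℂ)) at h
  simp only [star_smul, Matrix.smul_mul, Matrix.mul_smul, smul_smul, Complex.star_def, hcinv', one_smul] at h
  exact h

/-- **Schur's lemma, `SU(N)` form** (`N ≥ 2`): a `ℂ`-linear map on `M_N(ℂ)` commuting with every special-unitary conjugation
is `X ↦ a·X + b·tr(X)·1`. -/
theorem linearMap_eq_of_commute_specialUnitary_conj (hN : 2 ≤ N)
    (hT : ∀ (v : Matrix.specialUnitaryGroup (Fin N) ℂ) (X : Matrix (Fin N) (Fin N) ℂ),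
      T ((v : Matrix (Fin N) (Fin N) ℂ) * X * star (v : Matrix (Fin N) (Fin N) ℂ))
        = (v : Matrix (Fin N) (Fin N) ℂ) * T X * star (v : Matrix (Fin N) (Fin N) ℂ)) :
    ∃ a b : ℂ, ∀ X : Matrix (Fin N) (Fin N) ℂ, T X = a • X + b • (X.trace • (1 : Matrix (Fin N) (Fin N) ℂ)) := by
  haveI : NeZero N := ⟨by omega⟩
  exact linearMap_eq_of_commute_unitary_conj T hN (commute_unitary_conj_of_specialUnitary T hT)

end Commutant

end Summit.Ventures.LatticeQCDFlow.Scoring
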